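import Mathlib.Analysis.SpecialFunctions.Pow.Real
import Mathlib.Analysis.SpecialFunctions.Complex.Circle
import Mathlib.NumberTheory.PrimeCounting
import Mathlib.Order.Filter.AtTopBot.Basic
import Mathlib.Algebra.Polynomial.Eval.Defs
import Mathlib.Algebra.Squarefree.Basic
import Mathlib.Data.ZMod.Basic
import HarnessLib

/-!
# The largest prime factor of `n³ + 2` exceeds `X^{1+ϖ}` for a positive proportion of `n`
# (Heath-Brown 2001, Thm. 1; Irving 2015, Thm. 1.1)

Topic `Literature/NumberTheory/Sieve`; named facts (results in print, `def … : Prop`, D-0014)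
bearing on the routes `Summit.Parity.BatemanHorn.Theses.CubicKloosterman` and
`….CubicRoots` (work item `wi-17790`).  The item asks in the first place for the ENGINE of
D. R. Heath-Brown, *The largest prime factor of `X³ + 2`*, Proc. London Math. Soc. (3) 82 (2001)
554–596 — his Theorem 2 (a `q`-analogue of van der Corput's method for short Kloosterman sums to
suitably factorable moduli) and the level of distribution of `#{X < n ≤ 2X : d ∣ n³ + 2}` over
factorable `d ∈ (X^{1+δ}, X^{1+2δ}]`, `δ = 1/321`, that it yields; that paper is paywalled and not
held (acquisition `acq-02428`), and no held text restates Theorem 2 with its ranges, so those two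
statements are NOT vendored here.  What IS printed in a held source is the end result, Heath-Brown's
Theorem 1, restated verbatim by A. J. Irving, *The largest prime factor of `X³ + 2`*
(arXiv:1412.0024; Acta Arith. 171 (2015)), p. 3, together with Irving's improvement:

> "Specifically, let `ϖ = 10^{−303}` and suppose that `X` is sufficiently large. Heath-Brown proved
> that, for a positive proportion of the integers `n ∈ (X, 2X]`, the largest prime factor of `n³ + 2`
> exceeds `X^{1+ϖ}`."
>
> **Theorem 1.1** (Irving). Let `ϖ = 10^{−52}` and suppose that `X` is sufficiently large. Then, for
> at least a positive proportion of the integers `n ∈ (X, 2X]`, `n³ + 2` has a prime factor in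
> excess of `X^{1+ϖ}`. In particular `P(x; X³ + 2) ≫ x^{1+ϖ}`.

(Irving, §2, also records Heath-Brown's Lemmas 2.1–2.2 and the sieve lower bound Lemma 2.3,
`S ≥ (9.2 × 10⁻⁸ + o(1)) X` with `δ = 1/321`, whose sets `𝓛(K)` "can be chosen" as in the paywalled
paper — not a self-contained statement, hence not vendored either.)

* `HeathBrown2001_largestPrimeFactor_cubic` — Heath-Brown 2001, Thm. 1 (`ϖ = 10^{−303}`).
* `Irving2015_largestPrimeFactor_cubic` — Irving 2015, Thm. 1.1 (`ϖ = 10^{−52}`).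
* Proved: Irving's theorem implies Heath-Brown's (`…_of_irving`), by monotonicity of `X^{1+ϖ}`
  in `ϖ` for `X ≥ 1`.

## Rendering

"For a positive proportion of the integers `n ∈ (X, 2X]`, for `X` sufficiently large": there is
`c > 0` such that for all sufficiently large NATURAL numbers `X` (the printed `X` is real; integer
`X` is the weaker, sufficient reading) the number of `n ∈ (X, 2X]` (a `Finset.Ioc`) such that some
prime `p ∣ n³ + 2` satisfies `X^{1+ϖ} < p` (real power `Real.rpow`) is at least `c · X`.
`ϖ = 10^{−303}` resp. `10^{−52}` is written `1 / 10 ^ 303` resp. `1 / 10 ^ 52`.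

## Mathlib / tree search

Mathlib: `Nat.Prime`, `Finset.Ioc`, `Real.rpow`, `Filter.atTop`; no results on prime factors of
polynomial values.  Tree: `Literature.Barriers.ABC.largestPrimeFactor` (a `max 1 sup` helper in the
ABC barrier catalogue, not needed here), Hooley's log-power saving
`hooley_polyRoots_logPowerSaving` (`Literature/NumberTheory/Sieve`), the 119-file formalisation of
Heath-Brown's OTHER 2001 paper (*Primes represented by `x³ + 2y³`*, Acta Math.;
`HeathBrownCubic*.lean`) — unrelated to the present PLMS paper; `lean search 'n \^ 3 \+ 2|
largestPrimeFactor_cubic'`: nothing.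

## Proved steps of the printed proof (2026-08-15)

Heath-Brown's Chebyshev–Hooley lemma (Irving's Lemma 2.2) is PROVED in rational form, from the
tree's prime ideal theorem for the roots of `X³ + 2`, in the four files
`LargestPrimeFactorCubicLocal` (local densities `ν(p^e) ≤ 3`, counting, `log = log^{(1)} + log^{(2)}`),
`LargestPrimeFactorCubicMertens` (`θ_ν(x) = x + O(x/log²x)`, `∑_{p≤x} ν(p) log p/p ≤ log x + O(1)`),
`LargestPrimeFactorCubicSmoothSum` (`∑_{X<n≤2X} log^{(1)}(n³+2) ≤ X log X + O(X)`) and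
`LargestPrimeFactorCubicChebyshev` (`LargestPrimeFactorCubic.card_largePrime_ge_of_card_smoothLog_ge`,
the lemma with rate `O(X/log X)`; `…card_largePrime_eventually_ge`, the printed `o(1)` form).
Consequently BOTH named facts below are reduced to their sieve-theoretic core
(`LargestPrimeFactorCubic.HeathBrown2001_largestPrimeFactor_cubic_of_card_smoothLog_ge`,
`LargestPrimeFactorCubic.Irving2015_largestPrimeFactor_cubic_of_card_smoothLog_ge`): it remains
to show that for some `α, δ > 0` with `αδ/2 > 10⁻³⁰³` (resp. `> 10⁻⁵²`) and all large `X`, at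
least `αX` of the `n ∈ (X, 2X]` have `∑_{p ≤ 3X} v_p(n³+2) log p ≥ (1+δ) log X` — Heath-Brown's
divisor construction `KL ∣ n + ∛2`, `X^{1+δ} < N(KL) ≤ X^{1+2δ}`, resting on his Theorem 2
(level of distribution beyond `X` for factorable moduli; paywalled, not held) and, for Irving's
exponent, Irving's §§3–5 (elementary skeleton in `LargestPrimeFactorCubicProofs`).

## Appended 2026-08-15 (v2): Heath-Brown's Theorem 2, now that the primary is held

The PLMS paper became available (`paper:heathbrown2001-largest-prime-factor-i-x-i-sup`, read at
pp. 2–3, 6–10, 17–20 of the held text).  Its **Theorem 2** (p. 3, verbatim): "Let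
`q = q₀q₁⋯q_k` be a positive square-free integer. Suppose that `f(X), g(X)` are integral
polynomials with `deg f, deg g ≤ D`. Assume that for every prime factor `p` of `q` we have
`p > 2kD`. Moreover for all `p ∣ q`, suppose that there is no polynomial `h(X)`, with
`deg h ≤ k + 1`, for which `f(X) ≡ g(X)h(X) (mod p)`. (In particular we must have `p ∤ f(X)`.)
Then, for any `ε > 0` we have
`Σ_{A<n≤A+B} e_q(w f(n) \overline{g(n)}) ≪_{k,D,ε} q^ε { B (Δ/q₀)^{1/2^{k+1}}
+ B^{1−1/2^k} (q₀/Δ)^{1/2^{k+1}} + Σ_{j=1}^{k} B^{1−1/2^j} q_{k+1−j}^{1/2^j} }`, where `Δ = (q₀, w)`"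
— with the standing convention (p. 3) "only values of `n` for which `(g(n), q) = 1` are to be
included in the summation", `e_q(m) = exp(2πim/q)`, `\bar{·}` the inverse modulo `q`, `A, B`
integral — is vendored below as `HeathBrown2001_thm2_shortKloosterman` over the real definition
`shortKloostermanSum` (with the trivial bound `‖S‖ ≤ B` proved).  The "level of distribution of
`#{X < n ≤ 2X : d ∣ n³+2}` to factorable `d = N(KL) ∈ (X^{1+δ}, X^{1+2δ}]`" asked for by the item is
NOT a printed statement of the paper: what is printed is the internal Lemma 5 (p. 10), "We have
`S₁ = o(X)` providing that `δ ≤ 1/321`", for the specific remainder sum `S₁ = Σ_K Σ_{L∈𝓛(K)}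
(Σ_{d∣(Q,N(L))} λ_d) R_{KL}` of §2 (Rosser weights, the sets `𝒦`, `𝓛(K)`, `𝒬` of (2.4),
(2.9)–(2.17)); it is deduced from Theorem 2 with `k = 2`, `D = 1` in §5 and is not restated
outside that construction, so it is left unvendored (a prover of route `CubicKloosterman` needs
Theorem 2, which is the transferable engine, §10 p. 42: "`q` factorizes sufficiently well for
Theorem 2 to apply. This is the key to our success").

## References

* D. R. Heath-Brown, *The largest prime factor of `X³ + 2`*, Proc. London Math. Soc. (3) 82 (2001)
  554–596, doi:10.1112/plms/82.3.554, Thm. 1, Thm. 2 (p. 3), Lemma 5 (p. 10).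
  [`HeathBrown2001LargestPrimeFactorCubic`]
* A. J. Irving, *The largest prime factor of `X³ + 2`*, arXiv:1412.0024 (Acta Arith. 171 (2015)
  67–80), p. 3 (restatement of Heath-Brown's Thm. 1), Thm. 1.1, §2 Lemmas 2.1–2.3.
  [`Irving2014LargestPrimeFactorCubic`]
* C. Hooley, *On the greatest prime factor of a cubic polynomial*, J. reine angew. Math. 303/304
  (1978) (conditional `x^{1+1/30}`). [`Hooley1978CubicPrimeFactor`]
-/

noncomputable section

open Filter Finset

namespace Literature.NumberTheory.Sieve

/-- The counting function of the two theorems: the number of `n ∈ (X, 2X]` such that `n³ + 2` has a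
prime factor `p > X^{1+ϖ}` (classical `Finset.filter`: the real inequality is not decidable).
[cite: Irving2014LargestPrimeFactorCubic, Thm. 1.1 (the quantity counted)] -/
def cubicLargePrimeFactorCount (ϖ : ℝ) (X : ℕ) : ℕ :=
  open scoped Classical in
  ((Ioc X (2 * X)).filter fun n => ∃ p : ℕ, p.Prime ∧ p ∣ n ^ 3 + 2 ∧ (X : ℝ) ^ (1 + ϖ) < p).card

/-- **Heath-Brown 2001, Theorem 1** (as restated by Irving 2015, p. 3: "let `ϖ = 10^{−303}` and
suppose that `X` is sufficiently large. Heath-Brown proved that, for a positive proportion of the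
integers `n ∈ (X, 2X]`, the largest prime factor of `n³ + 2` exceeds `X^{1+ϖ}`"): there is `c > 0`
such that for all sufficiently large `X`, at least `c X` of the integers `n ∈ (X, 2X]` have a prime
factor of `n³ + 2` exceeding `X^{1 + 10^{−303}}`.
[cite: HeathBrown2001LargestPrimeFactorCubic, Thm. 1] [cite: Irving2014LargestPrimeFactorCubic, p. 3 (restatement)] -/
def HeathBrown2001_largestPrimeFactor_cubic : Prop :=
  ∃ c : ℝ, 0 < c ∧ ∀ᶠ X : ℕ in atTop,
    c * X ≤ (cubicLargePrimeFactorCount (1 / 10 ^ 303) X : ℝ)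

/-- **Irving 2015, Theorem 1.1** ("Let `ϖ = 10^{−52}` and suppose that `X` is sufficiently large.
Then, for at least a positive proportion of the integers `n ∈ (X, 2X]`, `n³ + 2` has a prime factor
in excess of `X^{1+ϖ}`"): there is `c > 0` such that for all sufficiently large `X`, at least `c X`
of the integers `n ∈ (X, 2X]` have a prime factor of `n³ + 2` exceeding `X^{1 + 10^{−52}}`.
[cite: Irving2014LargestPrimeFactorCubic, Thm. 1.1] -/
def Irving2015_largestPrimeFactor_cubic : Prop :=
  ∃ c : ℝ, 0 < c ∧ ∀ᶠ X : ℕ in atTop,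
    c * X ≤ (cubicLargePrimeFactorCount (1 / 10 ^ 52) X : ℝ)

/-! ### API -/

/-- The count is antitone in the exponent `ϖ` once `X ≥ 1`: a prime above `X^{1+ϖ'}` is above
`X^{1+ϖ}` for `ϖ ≤ ϖ'`. [folklore] -/
theorem cubicLargePrimeFactorCount_mono {ϖ ϖ' : ℝ} (h : ϖ ≤ ϖ') {X : ℕ} (hX : 1 ≤ X) :
    cubicLargePrimeFactorCount ϖ' X ≤ cubicLargePrimeFactorCount ϖ X := by
  classical
  unfold cubicLargePrimeFactorCount
  refine card_le_card (fun n hn => ?_)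
  simp only [mem_filter] at hn ⊢
  obtain ⟨hn, p, hp, hdvd, hlt⟩ := hn
  refine ⟨hn, p, hp, hdvd, lt_of_le_of_lt ?_ hlt⟩
  have hX' : (1 : ℝ) ≤ X := by exact_mod_cast hX
  exact Real.rpow_le_rpow_of_exponent_le hX' (by linarith)

/-- Irving's theorem (exponent `10^{−52}`) implies Heath-Brown's (exponent `10^{−303}`), with the
same proportion `c`. [cite: Irving2014LargestPrimeFactorCubic, Thm. 1.1 and p. 3] -/
theorem HeathBrown2001_largestPrimeFactor_cubic_of_irving (h : Irving2015_largestPrimeFactor_cubic) :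
    HeathBrown2001_largestPrimeFactor_cubic := by
  obtain ⟨c, hc, hev⟩ := h
  refine ⟨c, hc, ?_⟩
  filter_upwards [hev, eventually_ge_atTop 1] with X hX h1
  refine hX.trans ?_
  have hle : (1 : ℝ) / 10 ^ 303 ≤ 1 / 10 ^ 52 :=
    one_div_le_one_div_of_le (by positivity) (pow_le_pow_right₀ (by norm_num) (by norm_num))
  exact_mod_cast cubicLargePrimeFactorCount_mono hle h1

/-! ### Heath-Brown's Theorem 2: the `q`-analogue of van der Corput for short Kloosterman sums
to factorable moduli (appended v2) -/

open Polynomial in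
/-- **The short Kloosterman-type sum of Heath-Brown's Theorem 2**:
`S = Σ_{A < n ≤ A+B, (g(n), q) = 1} e_q(w · f(n) · \overline{g(n)})`, `e_q(m) = exp(2πim/q)`,
`\overline{g(n)}` the inverse of `g(n)` modulo `q`, the summation restricted to the `n` with
`g(n)` invertible modulo `q` (p. 3: "only values of `n` for which `(g(n), q) = 1` are to be
included in the summation").  The residue `w f(n) \overline{g(n)} ∈ ℤ/q` is read through
`ZMod.val`. [cite: HeathBrown2001LargestPrimeFactorCubic, Thm. 2 (the sum S, p. 3)] -/
def shortKloostermanSum (q : ℕ) (f g : ℤ[X]) (w A : ℤ) (B : ℕ) : ℂ :=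
  open scoped Classical in
  ∑ n ∈ Ioc A (A + B),
    if IsUnit ((g.eval n : ℤ) : ZMod q) then
      Complex.exp ((2 * Real.pi *
        ((((w : ZMod q) * ((f.eval n : ℤ) : ZMod q) * ((g.eval n : ℤ) : ZMod q)⁻¹).val : ℕ) : ℝ) /
          q : ℝ) * Complex.I)
    else 0

open Polynomial in
/-- NAMED FACT — **Heath-Brown 2001, Theorem 2** (the `q`-analogue of van der Corput's method for
incomplete Kloosterman sums to a factorable modulus; p. 3, quoted in the module docstring).  For
all `k, D ∈ ℕ` and `ε > 0` there is `C = C(k, D, ε)` such that: for every positive square-free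
`q = q₀ · q₁ ⋯ q_k` (`qs i = q_{i+1}`), all integral polynomials `f, g` of degree `≤ D` such that
every prime `p ∣ q` has `p > 2kD` and, for every prime `p ∣ q`, there is NO polynomial `h` over
`𝔽_p` of degree `≤ k + 1` with `f ≡ g · h (mod p)`, all integers `w`, `A` and all `B ∈ ℕ`,
`|S| ≤ C q^ε { B (Δ/q₀)^{1/2^{k+1}} + B^{1−1/2^k} (q₀/Δ)^{1/2^{k+1}} + Σ_{j=1}^{k} B^{1−1/2^j}
q_{k+1−j}^{1/2^j} }`, `Δ = (q₀, w)` (the index `k + 1 − j`, `j = 1…k`, is `Fin.rev`).  Users take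
`(h : HeathBrown2001_thm2_shortKloosterman)`. [cite: HeathBrown2001LargestPrimeFactorCubic, Thm. 2] -/
def HeathBrown2001_thm2_shortKloosterman : Prop :=
  ∀ (k D : ℕ) (ε : ℝ), 0 < ε → ∃ C : ℝ,
    ∀ (q q₀ : ℕ) (qs : Fin k → ℕ) (f g : ℤ[X]) (w A : ℤ) (B : ℕ),
      q = q₀ * ∏ i, qs i → 0 < q → Squarefree q →
      f.natDegree ≤ D → g.natDegree ≤ D →
      (∀ p : ℕ, p.Prime → p ∣ q → 2 * k * D < p) →
      (∀ p : ℕ, p.Prime → p ∣ q → ¬ ∃ h : (ZMod p)[X], h.natDegree ≤ k + 1 ∧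
        f.map (Int.castRingHom (ZMod p)) = g.map (Int.castRingHom (ZMod p)) * h) →
      ‖shortKloostermanSum q f g w A B‖ ≤
        C * (q : ℝ) ^ ε *
          ((B : ℝ) * ((Int.gcd (q₀ : ℤ) w : ℝ) / q₀) ^ ((1 : ℝ) / 2 ^ (k + 1)) +
            (B : ℝ) ^ (1 - (1 : ℝ) / 2 ^ k) * ((q₀ : ℝ) / Int.gcd (q₀ : ℤ) w) ^ ((1 : ℝ) / 2 ^ (k + 1)) +
            ∑ j : Fin k, (B : ℝ) ^ (1 - (1 : ℝ) / 2 ^ (j.val + 1)) *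
              (qs j.rev : ℝ) ^ ((1 : ℝ) / 2 ^ (j.val + 1)))

open Polynomial in
/-- The trivial bound `|S| ≤ B` (each of the `B` terms is `0` or a complex number of modulus `1`);
in particular the content of Theorem 2 is the saving over `B`. [folklore] -/
theorem norm_shortKloostermanSum_le (q : ℕ) (f g : ℤ[X]) (w A : ℤ) (B : ℕ) :
    ‖shortKloostermanSum q f g w A B‖ ≤ B := by
  classical
  unfold shortKloostermanSum
  refine (norm_sum_le _ _).trans ?_
  have hcard : ((Ioc A (A + B)).card : ℝ) = B := by
    rw [Int.card_Ioc]
    simp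
  have hterm : ∀ n ∈ Ioc A (A + B),
      ‖(if IsUnit ((g.eval n : ℤ) : ZMod q) then
          Complex.exp ((2 * Real.pi *
            ((((w : ZMod q) * ((f.eval n : ℤ) : ZMod q) * ((g.eval n : ℤ) : ZMod q)⁻¹).val : ℕ) :
              ℝ) / q : ℝ) * Complex.I)
        else 0 : ℂ)‖ ≤ 1 := by
    intro n _
    split_ifs
    · exact le_of_eq (Complex.norm_exp_ofReal_mul_I _)
    · simp
  calc _ ≤ ∑ _n ∈ Ioc A (A + B), (1 : ℝ) := Finset.sum_le_sum hterm
    _ = B := by rw [Finset.sum_const, nsmul_eq_mul, mul_one, hcard]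

open Polynomial in
/-- The empty sum: `B = 0` gives `S = 0`. [folklore] -/
theorem shortKloostermanSum_zero (q : ℕ) (f g : ℤ[X]) (w A : ℤ) :
    shortKloostermanSum q f g w A 0 = 0 := by
  unfold shortKloostermanSum
  simp

end Literature.NumberTheory.Sieve
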